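import Literature.NumberTheory.PAdicHodge.FilZeroCoboundaryDescent
import Literature.NumberTheory.PAdicHodge.BdRBaseChangeFiltered
import Literature.NumberTheory.PAdicHodge.BdRCyclotomic
import Literature.NumberTheory.PAdicHodge.DualExpElliptic
import Literature.NumberTheory.GaloisRepresentations.InducedGaloisRep
import HarnessLib

/-!
# `Fil⁰`-coboundaries descend along a finite extension of the `p`-adic base field (`B_dR(L) = B_dR(K)`)

Topic `Literature/NumberTheory/PAdicHodge`; §1 extends the tree structure `PeriodRingData` (namespace
`Literature.NumberTheory.GaloisRepresentations.PeriodRingData`), §2 lives in `Literature.NumberTheory.PAdicHodge`. THEOREMS ONLY (no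
definition, no named fact, no instance, no `sorry`). Sequel of `FilZeroCoboundaryDescent` (coset averaging: a `Fil⁰`-cocycle which is a
`Fil⁰`-coboundary on a finite-index subgroup is a `Fil⁰`-coboundary) and of `BdRBaseChangeFiltered` (Brinon–Conrad p. 80: the FILTERED,
`Γ_L`-equivariant, `ℚ_p`-linear ring isomorphism `Φ : B_dR(K) ≃ B_dR(L)` for a finite extension `L/K` of `p`-adic fields).

* §1 (abstract data `𝔅₁ = (B₁, Γ₁, E₁)`, `𝔅₂ = (B₂, Γ₂, E₂)` over `P`, `r : Γ₂ →ₜ* Γ₁` with finite-index range, `Φ : B₁ ≃ B₂` `P`-linear,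
  `r`-equivariant and with `Φ⁻¹(Fil⁰B₂) ⊆ Fil⁰B₁`): **`IsFilZeroCoboundary.of_restrict_of_ringEquiv`** — for a crossed homomorphism `η` of
  `ρ`, if `τ ↦ 1 ⊗ η(r τ)` is a `Fil⁰`-coboundary of `B₂ ⊗ V|_r`, then `σ ↦ 1 ⊗ η(σ)` is a `Fil⁰`-coboundary of `B₁ ⊗ V`: transport the
  integrating element along `Φ⁻¹ ⊗ 1` (`Fil⁰ ↦ Fil⁰`, `τ`-action ↦ `r τ`-action), then average over `Γ₁/r(Γ₂)`.
* §2 (`p`-adic fields, `K → L` a continuous embedding, `[L : K] < ∞`): **`isFilZeroCoboundary_of_restrictField`** for any continuous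
  `ℚ_p`-representation `ρ` of `Γ_K` (`Φ` from `exists_fracBdR_ringEquiv_filtered`, `[Γ_K : res Γ_L] = [L : K]`), and the elliptic corollary
  **`isFilZeroCoboundary_rationalTateRep_of_restricted`**: a crossed homomorphism `η : Γ_K → T_pE` (`E/K` elliptic) whose restriction
  to `Γ_L` gives a `Fil⁰`-coboundary of `B_dR(L) ⊗ V_pE|_{Γ_L}` (the currency `restrictedRationalTateRep E L p` of the K1 capstones
  `KummerFilZeroCoboundaryRamifiedOfWeil`, `L = K(ϖ)` the field of good reduction) gives a `Fil⁰`-coboundary of `B_dR(K) ⊗ V_pE`.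

Use: descent of brick K1 («Kummer classes of rational points die in `H¹(K, B_dR⁺ ⊗ V_pE)`», crux K★ `stmt-BirchSwinnertonDyer-22226`) from the
field of good reduction to the base field where the curve is additive. BSD / K★ are not proved by any of this.

## References
* [BrinonConrad2009] O. Brinon, B. Conrad, *CMI notes on p-adic Hodge theory* (2009), Prop. 6.3.8 and p. 80 (`B_dR` depends only on
  `𝒪_{ℂ_K}` with its Galois action).
* [NeukirchSchmidtWingberg2008] J. Neukirch, A. Schmidt, K. Wingberg, *Cohomology of Number Fields* (2008), Cor. (1.5.7).
* [BlochKato1990] S. Bloch, K. Kato (1990), Lemma 3.8.1, Example 3.11.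
-/

noncomputable section

open scoped TensorProduct

/-! ## §1 Transport of `Fil⁰`-coboundaries along an equivariant filtered isomorphism of period rings -/

namespace Literature.NumberTheory.GaloisRepresentations.PeriodRingData

section Transport

-- Mathlib's own global value of `maxSynthPendingDepth` (instance problems on `𝔅.B ⊗[P] M`, see `PAdicHodgeProofs`).
set_option maxSynthPendingDepth 3

universe u₁ u₂ v v₁ v₂ w₁ w₂ w'

variable {Γ₁ : Type u₁} {Γ₂ : Type u₂} [Group Γ₁] [Group Γ₂]
  {P : Type v} {E₁ : Type v₁} {E₂ : Type v₂} [Field P] [Field E₁] [Field E₂] [Algebra P E₁] [Algebra P E₂]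
  {M : Type w'} [AddCommGroup M] [Module P M]
  (𝔅₁ : PeriodRingData.{u₁, v, v₁, w₁} Γ₁ P E₁) (𝔅₂ : PeriodRingData.{u₂, v, v₂, w₂} Γ₂ P E₂)
  (Φ : 𝔅₁.B ≃+* 𝔅₂.B) (hΦP : ∀ c : P, Φ (algebraMap P 𝔅₁.B c) = algebraMap P 𝔅₂.B c)

include hΦP in
/-- `Φ⁻¹` is `P`-linear. [folklore] -/
private theorem symm_algebraMap (c : P) : Φ.symm (algebraMap P 𝔅₂.B c) = algebraMap P 𝔅₁.B c := by
  rw [← hΦP, RingEquiv.symm_apply_apply]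

variable [TopologicalSpace Γ₁] [TopologicalSpace Γ₂] (r : Γ₂ →ₜ* Γ₁) (hΦ : ∀ (τ : Γ₂) (b : 𝔅₁.B), Φ (r τ • b) = τ • Φ b)

include hΦ in
/-- `Φ⁻¹` intertwines `τ` with `r τ`. [folklore] -/
private theorem symm_smul (τ : Γ₂) (b : 𝔅₂.B) : Φ.symm (τ • b) = r τ • Φ.symm b :=
  Φ.injective (by rw [RingEquiv.apply_symm_apply, hΦ, RingEquiv.apply_symm_apply])

variable [TopologicalSpace P] [TopologicalSpace M] (ρ : ContinuousRep Γ₁ P M)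

include hΦP hΦ in
/-- **Transport of `Fil⁰`-coboundaries along `Φ⁻¹ ⊗ 1` and descent.** `r : Γ₂ →ₜ* Γ₁` with finite-index range, `Φ : B₁ ≃ B₂` `P`-linear,
`r`-equivariant, with `Φ⁻¹(Fil⁰B₂) ⊆ Fil⁰B₁`, `char E₁ = 0`; `η` a crossed homomorphism of `ρ`. If `τ ↦ 1 ⊗ η(r τ)` is a `Fil⁰`-coboundary
of `B₂ ⊗ V|_r`, then `σ ↦ 1 ⊗ η(σ)` is a `Fil⁰`-coboundary of `B₁ ⊗ V`. [cite: BrinonConrad2009, Prop. 6.3.8]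
[cite: NeukirchSchmidtWingberg2008, Cor. (1.5.7)] -/
theorem IsFilZeroCoboundary.of_restrict_of_ringEquiv [CharZero E₁] [(r.toMonoidHom.range).FiniteIndex]
    (hΦfil : ∀ b : 𝔅₂.B, b ∈ 𝔅₂.fil 0 → Φ.symm b ∈ 𝔅₁.fil 0)
    {η : Γ₁ → M} (hη : ∀ σ τ, η (σ * τ) = η σ + ρ σ (η τ))
    (h : 𝔅₂.IsFilZeroCoboundary (ρ.restrict r) fun τ => (1 : 𝔅₂.B) ⊗ₜ[P] η (r τ)) :
    𝔅₁.IsFilZeroCoboundary ρ fun σ => (1 : 𝔅₁.B) ⊗ₜ[P] η σ := by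
  -- the `P`-linear base change `g = Φ⁻¹ ⊗ 1`
  obtain ⟨g, hg⟩ : ∃ g : 𝔅₂.B ⊗[P] M →ₗ[P] 𝔅₁.B ⊗[P] M, ∀ (b : 𝔅₂.B) (m : M), g (b ⊗ₜ m) = Φ.symm b ⊗ₜ m :=
    ⟨(AlgEquiv.ofRingEquiv (f := Φ.symm) (symm_algebraMap 𝔅₁ 𝔅₂ Φ hΦP)).toLinearMap.rTensor M, fun b m => by
      rw [LinearMap.rTensor_tmul, AlgEquiv.toLinearMap_apply, AlgEquiv.ofRingEquiv_apply]⟩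
  -- `g` maps `Fil⁰(B₂ ⊗ V)` into `Fil⁰(B₁ ⊗ V)`
  have hgfil : ∀ {x : 𝔅₂.B ⊗[P] M}, x ∈ 𝔅₂.filTensor M 0 → g x ∈ 𝔅₁.filTensor M 0 := by
    rintro x ⟨z, rfl⟩
    induction z using TensorProduct.induction_on with
    | zero => rw [map_zero, map_zero]; exact Submodule.zero_mem _
    | tmul f m =>
      rw [TensorProduct.AlgebraTensorModule.map_tmul, Submodule.subtype_apply, LinearMap.id_apply, hg]
      exact ⟨(⟨Φ.symm (f : 𝔅₂.B), hΦfil _ f.2⟩ : 𝔅₁.fil 0) ⊗ₜ[P] m, by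
        rw [TensorProduct.AlgebraTensorModule.map_tmul]; rfl⟩
    | add y z hy hz => rw [map_add, map_add]; exact Submodule.add_mem _ hy hz
  -- `g` intertwines `τ` on `B₂ ⊗ V|_r` with `r τ` on `B₁ ⊗ V`
  have hgrep : ∀ (τ : Γ₂) (x : 𝔅₂.B ⊗[P] M), g (𝔅₂.tensorRep (ρ.restrict r) τ x) = 𝔅₁.tensorRep ρ (r τ) (g x) := by
    intro τ x
    induction x using TensorProduct.induction_on with
    | zero => simp only [map_zero]
    | tmul b m =>
      rw [tensorRep_apply_tmul, hg, hg, tensorRep_apply_tmul, ContinuousRep.restrict_apply, symm_smul 𝔅₁ 𝔅₂ Φ r hΦ]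
    | add x y hx hy => rw [map_add, map_add, hx, hy, ← map_add, ← map_add]
  -- transport the integrating element, then average over the cosets of `r(Γ₂)`
  obtain ⟨b₂, hb₂, hb⟩ := h
  refine IsFilZeroCoboundary.of_range 𝔅₁ ρ r.toMonoidHom (fun σ τ => one_tmul_cocycle 𝔅₁ ρ hη σ τ)
    (fun σ => one_tmul_mem_filTensor_zero (η σ)) ⟨g b₂, hgfil hb₂, fun τ => ?_⟩
  have h1 : g ((1 : 𝔅₂.B) ⊗ₜ[P] η (r τ)) = (1 : 𝔅₁.B) ⊗ₜ[P] η (r τ) := by rw [hg, map_one]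
  have hbτ : ((1 : 𝔅₂.B) ⊗ₜ[P] η (r τ) : 𝔅₂.B ⊗[P] M) = 𝔅₂.tensorRep (ρ.restrict r) τ b₂ - b₂ := hb τ
  change ((1 : 𝔅₁.B) ⊗ₜ[P] η (r τ) : 𝔅₁.B ⊗[P] M) = 𝔅₁.tensorRep ρ (r τ) (g b₂) - g b₂
  rw [← h1, hbτ, map_sub, hgrep]

end Transport

end Literature.NumberTheory.GaloisRepresentations.PeriodRingData

/-! ## §2 `p`-adic fields: `B_dR(L) = B_dR(K)` -/

namespace Literature.NumberTheory.PAdicHodge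

open Literature Literature.NumberTheory.GaloisRepresentations Literature.NumberTheory.EllipticCurves WeierstrassCurve
open Literature.NumberTheory.GaloisRepresentations.IsNonarchimedeanLocalField Field ValuativeRel WittVector

variable {K L : Type} [Field K] [ValuativeRel K] [TopologicalSpace K] [IsNonarchimedeanLocalField K] [CharZero K]
  [Field L] [ValuativeRel L] [TopologicalSpace L] [IsNonarchimedeanLocalField L] [CharZero L] [Algebra K L]
  {p : ℕ} [Fact p.Prime]
  [Fact (¬ IsUnit ((p : ℕ) : integerC K))] [IsAdicComplete (Ideal.span {((p : ℕ) : integerC K)}) (integerC K)]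
  [Fact (¬ IsUnit ((p : ℕ) : integerC L))] [IsAdicComplete (Ideal.span {((p : ℕ) : integerC L)}) (integerC L)]
  (hK : valuation K p < 1) (hL : valuation L p < 1) [Algebra ℚ_[p] K] [Algebra ℚ_[p] L]

/-- **`Fil⁰`-coboundaries descend along a finite extension of `p`-adic fields.** `K → L` a continuous embedding of `p`-adic fields with
`[L : K] < ∞`, `ρ` a continuous `ℚ_p`-representation of `Γ_K` on `V`, `η : Γ_K → V` a crossed homomorphism. If `τ ↦ 1 ⊗ η(res τ)` is a
`Fil⁰`-coboundary of `B_dR(L) ⊗ V|_{Γ_L}` (Fontaine's `bdRPeriodRingData hL`), then `σ ↦ 1 ⊗ η(σ)` is a `Fil⁰`-coboundary of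
`B_dR(K) ⊗ V`: transport along the filtered equivariant `Φ : B_dR(K) ≃ B_dR(L)` of `exists_fracBdR_ringEquiv_filtered`, then
`cor ∘ res = [L : K]`. [cite: BrinonConrad2009, Prop. 6.3.8] [cite: NeukirchSchmidtWingberg2008, Cor. (1.5.7)] [cite: BlochKato1990, Lemma 3.8.1] -/
theorem isFilZeroCoboundary_of_restrictField (hcont : Continuous (algebraMap K L)) [FiniteDimensional K L]
    {M : Type} [AddCommGroup M] [Module ℚ_[p] M] [TopologicalSpace M] (ρ : GaloisRep K ℚ_[p] M)
    {η : absoluteGaloisGroup K → M} (hη : ∀ σ τ, η (σ * τ) = η σ + ρ σ (η τ))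
    (h : (bdRPeriodRingData (F := L) (p := p) hL).IsFilZeroCoboundary (ρ.restrictField L) fun τ =>
      ((1 : (bdRPeriodRingData (F := L) (p := p) hL).B) ⊗ₜ[ℚ_[p]] η (absGaloisRestrict K L τ) :
        (bdRPeriodRingData (F := L) (p := p) hL).B ⊗[ℚ_[p]] M)) :
    (bdRPeriodRingData (F := K) (p := p) hK).IsFilZeroCoboundary ρ fun σ =>
      ((1 : (bdRPeriodRingData (F := K) (p := p) hK).B) ⊗ₜ[ℚ_[p]] η σ :
        (bdRPeriodRingData (F := K) (p := p) hK).B ⊗[ℚ_[p]] M) := by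
  have hFK := surjective_fontaineTheta_integerC hK
  have hFL := surjective_fontaineTheta_integerC hL
  have halgK : ∀ c : ℚ_[p], algebraMap ℚ_[p] K c = LocalField.padicRingHom K p hK c := fun c =>
    RingHom.congr_fun (LocalField.ringHom_padic_ext _ _) c
  have halgL : ∀ c : ℚ_[p], algebraMap ℚ_[p] L c = LocalField.padicRingHom L p hL c := fun c =>
    RingHom.congr_fun (LocalField.ringHom_padic_ext _ _) c
  haveI : IsDomain (BDeRhamPlus (integerC K) p) := isDomain_bDeRhamPlus hFK
  haveI : IsDomain (BDeRhamPlus (integerC L) p) := isDomain_bDeRhamPlus hFL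
  obtain ⟨Φ, hΦgal, hΦqp, -, -, hΦfil⟩ := exists_fracBdR_ringEquiv_filtered (ℓ := p) hcont hK hL hFK hFL
  -- `[Γ_K : res Γ_L] = [L : K] < ∞`
  haveI : ((absGaloisRestrict K L).toMonoidHom.range).FiniteIndex := Subgroup.finiteIndex_of_finite_quotient
  refine PeriodRingData.IsFilZeroCoboundary.of_restrict_of_ringEquiv (bdRPeriodRingData (F := K) (p := p) hK)
    (bdRPeriodRingData (F := L) (p := p) hL) Φ (fun c => ?_) (absGaloisRestrict K L) (fun τ b => hΦgal τ b) ρ (fun b hb => ?_) hη h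
  · -- `Φ` is `ℚ_p`-linear: both `ℚ_p`-structures are `ℚ_p → F ↪ B_dR⁺(F)`, i.e. `qpToBdR`
    rw [PeriodRingData.algebraMap_eq, PeriodRingData.algebraMap_eq, algebraMap_bdRPeriodRingData hFK hK,
      algebraMap_bdRPeriodRingData hFL hL, embBdRHom_algebraMap_padic hK hFK halgK, embBdRHom_algebraMap_padic hL hFL halgL]
    exact hΦqp c
  · -- `Φ⁻¹(Fil⁰ B_dR(L)) ⊆ Fil⁰ B_dR(K)` (the isomorphism is filtered)
    have h0 := (hΦfil 0 (Φ.symm b)).2 (by rw [RingEquiv.apply_symm_apply]; exact hb)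
    exact h0

/-- **Elliptic corollary (the currency of the K1 capstones).** `E/K` elliptic, `K → L` a continuous embedding of `p`-adic fields with
`[L : K] < ∞` (e.g. `L = K(ϖ)` the field over which `E` acquires good reduction), `η : Γ_K → T_pE` a crossed homomorphism
(`η(στ) = η(σ) + σ·η(τ)`). If `τ ↦ 1 ⊗ η(res τ)` is a `Fil⁰`-coboundary of `B_dR(L) ⊗ V_pE|_{Γ_L}` (`restrictedRationalTateRep E L p`,
the conclusion of `isFilZeroCoboundary_kummerCocycleO_restricted_of_matching_explicitModel` over `L`), then `σ ↦ 1 ⊗ η(σ)` is a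
`Fil⁰`-coboundary of `B_dR(K) ⊗ V_pE` (`rationalTateRep E p`): the Kummer class dies over the ADDITIVE base field as soon as it dies over
the field of good reduction. [cite: BlochKato1990, Lemma 3.8.1, Example 3.11] [cite: BrinonConrad2009, Prop. 6.3.8] -/
theorem isFilZeroCoboundary_rationalTateRep_of_restricted (hcont : Continuous (algebraMap K L)) [FiniteDimensional K L]
    (E : WeierstrassCurve K) [E.IsElliptic] {η : absoluteGaloisGroup K → E.tateModule p}
    (hη : ∀ σ τ, η (σ * τ) = η σ + σ • η τ)
    (h : (bdRPeriodRingData (F := L) (p := p) hL).IsFilZeroCoboundary (restrictedRationalTateRep E L p) fun τ =>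
      ((1 : (bdRPeriodRingData (F := L) (p := p) hL).B) ⊗ₜ[ℚ_[p]] TateModule.toRational p (η (absGaloisRestrict K L τ)) :
        (bdRPeriodRingData (F := L) (p := p) hL).B ⊗[ℚ_[p]] E.rationalTateModule p)) :
    (bdRPeriodRingData (F := K) (p := p) hK).IsFilZeroCoboundary (rationalTateRep E p) fun σ =>
      ((1 : (bdRPeriodRingData (F := K) (p := p) hK).B) ⊗ₜ[ℚ_[p]] TateModule.toRational p (η σ) :
        (bdRPeriodRingData (F := K) (p := p) hK).B ⊗[ℚ_[p]] E.rationalTateModule p) :=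
  isFilZeroCoboundary_of_restrictField hK hL hcont (rationalTateRep E p) (η := fun σ => TateModule.toRational p (η σ))
    (fun σ τ => by
      rw [hη, map_add]
      rfl) h

end Literature.NumberTheory.PAdicHodge

end
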